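import Mathlib
import HarnessLib

/-!
# The socle of a monogenic module over the group ring of a cyclic `p`-group, elementwise and «modulo `N`» —
# the algebra behind INJ⁺@2 ⟸ «`E⁺(ℚ_{2,n})/2` is cyclic over `𝔽₂[G_n]`» (route `ThetaPartnerAtTwo`, crux K4
# `SignedControlAtTwo`, stmt-BirchSwinnertonDyer-20309, line `eulerchar` v4, registered stub `stub_plusLocalInjTwo`)

Seat `prover-bsd-wall-tp2-p3-w3` (width seat 3/3). PURE ALGEBRA (Mathlib only); nothing about any curve is asserted.

WHY. The sequel files reduce the registered stub INJ⁺@2 («`r₂⁺` is injective») to (LIFT⁺@2) «`Γ_{ℚ₂}`-invariant classes of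
`(⋃ₙ E⁺(ℚ_{2,n})) ⊗ ℚ₂/ℤ₂` come from `E(ℚ₂)`» (landed: `…PlusLocalInjOfLift`), then to its `k = 1` case layerwise
(MOD2⁺: the `G_n`-invariants of `E⁺_n/2E⁺_n` are the line of `E(ℚ₂)`), and MOD2⁺ to (CYC⁺): «`E⁺_n/2E⁺_n` is a CYCLIC
module over `𝔽₂[G_n]`» — Kobayashi's generation statement (Prop. 8.12: `E⁺` is generated by the trace-compatible Honda point)
read at `2`. The step CYC ⇒ MOD2 is this file: over the group ring of a CYCLIC `p`-group `G = ⟨g⟩` acting on an `𝔽_p`-space,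
`D = g − 1` is nilpotent (`(g − 1)^{p^a} ≡ g^{p^a} − 1 (mod p)`), so a monogenic module `𝔽_p[G]·d̄` has the basis
`d̄, Dd̄, …, D^{r−1}d̄` and its `G`-fixed vectors (`ker D`) form the LINE `𝔽_p · D^{r−1} d̄` (the socle of the uniserial
`𝔽_p[x]/x^r`). Everything is written «modulo a subgroup `N ⊇ pV`» of an abelian group `V` (no quotient types), for an additive
endomorphism `D` of `V` preserving `N` and an element `d`:

* `pow_apply_mem_of_mem`, `pow_apply_mem_of_le` — bookkeeping (`D^k N ⊆ N`; `D^k d ∈ N` for `k ≥ r` once `D^r d ∈ N`).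
* `exists_sum_sub_mem_of_mem_closure` — every element of the subgroup generated by the `D^j d` is `≡ ∑_{j<r} a_j D^j d (mod N)`.
* `dvd_coeff_of_sum_mem` — INDEPENDENCE mod `N`: if `r` is minimal with `D^r d ∈ N` and `∑_{j<r} a_j D^j d ∈ N` then `p ∣ a_j`
  for all `j < r` (apply `D^{r−1−j₀}` at the least bad index `j₀`; Bézout).
* `exists_socle_generator` — **THE SOCLE LEMMA**: if `D^r d ∈ N` for some `r` and `V = ⟨D^j d⟩_j + N`, there is `s ∈ V` with
  `{v : D v ∈ N} ⊆ ℤ s + N`.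
* `pow_prime_pow_sub_one_apply_mem` — NILPOTENCY mod `p`: `((φ − 1)^{p^a}) d ∈ N` whenever `φ^{p^a} d = d`
  (`Commute.add_pow_prime_pow_eq'`: `(x + y)^{p^a} = x^{p^a} + y^{p^a} + p·(…)`).
* `closure_range_pow_smul_le` — `⟨φ^j d⟩_j ≤ ⟨(φ − 1)^j d⟩_j` (the orbit span is the `D`-span).

HONEST FRAMING: THEOREMS ONLY (no definition, no named fact, no `sorry`); closes no item; BSD is not proved by any of this.

References: [Kobayashi2003] S. Kobayashi, Invent. Math. 152 (2003), Prop. 8.12 (pp. 17–18), Thm. 6.2; [BDKim2013] B. D. Kim,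
J. Aust. Math. Soc. 95 (2013), proof of Cor. 3.15 (p. 199); [SerreLocalFields1979] IX §1 (cohomology of cyclic groups),
VIII §4 (uniserial modules over `𝔽_p[ℤ/p^n]`).
-/

set_option autoImplicit false
-- the Theorems namespace of this sub repeats the summit name by design (D-0017 nested layout)
set_option linter.dupNamespace false

open Finset

namespace Summit.BirchSwinnertonDyer.BirchSwinnertonDyer.Theorems.SignedEC

section Socle

variable {V : Type*} [AddCommGroup V] (N : AddSubgroup V) (D : AddMonoid.End V) (d : V)

/-- `(f + g) v = f v + g v` in `AddMonoid.End V` (definitional). [folklore] -/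
theorem addMonoidEnd_add_apply (f g : AddMonoid.End V) (v : V) : (f + g) v = f v + g v := rfl

/-- `(f - g) v = f v - g v` in `AddMonoid.End V` (definitional). [folklore] -/
theorem addMonoidEnd_sub_apply (f g : AddMonoid.End V) (v : V) : (f - g) v = f v - g v := rfl

/-- `(-f) v = -(f v)` in `AddMonoid.End V` (definitional). [folklore] -/
theorem addMonoidEnd_neg_apply (f : AddMonoid.End V) (v : V) : (-f) v = -(f v) := rfl

/-- `(f * g) v = f (g v)` in `AddMonoid.End V` (definitional). [folklore] -/
theorem addMonoidEnd_mul_apply (f g : AddMonoid.End V) (v : V) : (f * g) v = f (g v) := rfl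

/-- Powers of an endomorphism preserving `N` preserve `N`. [folklore] -/
theorem pow_apply_mem_of_mem (hDN : ∀ v ∈ N, D v ∈ N) (k : ℕ) {v : V} (hv : v ∈ N) : (D ^ k) v ∈ N := by
  induction k with
  | zero => rw [pow_zero, AddMonoid.End.one_apply]; exact hv
  | succ k ih => rw [pow_succ', addMonoidEnd_mul_apply]; exact hDN _ ih

/-- `D^m (D^j d) = D^{m+j} d`. [folklore] -/
theorem pow_apply_pow_apply (m j : ℕ) (v : V) : (D ^ m) ((D ^ j) v) = (D ^ (m + j)) v := by
  rw [pow_add, addMonoidEnd_mul_apply]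

/-- Once `D^r d ∈ N`, `D^k d ∈ N` for every `k ≥ r`. [folklore] -/
theorem pow_apply_mem_of_le (hDN : ∀ v ∈ N, D v ∈ N) {r : ℕ} (hr : (D ^ r) d ∈ N) {k : ℕ} (hk : r ≤ k) :
    (D ^ k) d ∈ N := by
  obtain ⟨j, rfl⟩ := Nat.exists_eq_add_of_le hk
  rw [add_comm, ← pow_apply_pow_apply]
  exact pow_apply_mem_of_mem N D hDN j hr

/-- **Normal form modulo `N`.** Every element of the subgroup generated by the `D^j d` is congruent modulo `N` to an
integral combination `∑_{j<r} a_j D^j d` of the first `r` of them, as soon as `D^r d ∈ N`. [folklore] -/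
theorem exists_sum_sub_mem_of_mem_closure (hDN : ∀ v ∈ N, D v ∈ N) {r : ℕ} (hr : (D ^ r) d ∈ N) {v : V}
    (hv : v ∈ AddSubgroup.closure (Set.range fun j : ℕ ↦ (D ^ j) d)) :
    ∃ a : ℕ → ℤ, v - ∑ j ∈ range r, a j • (D ^ j) d ∈ N := by
  induction hv using AddSubgroup.closure_induction with
  | mem x hx =>
    obtain ⟨j, rfl⟩ := hx
    by_cases hj : j < r
    · refine ⟨fun i ↦ if i = j then 1 else 0, ?_⟩
      simp only [ite_smul, one_smul, zero_smul, sum_ite_eq', mem_range, hj, if_true, sub_self]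
      exact N.zero_mem
    · refine ⟨0, ?_⟩
      simp only [Pi.zero_apply, zero_smul, sum_const_zero, sub_zero]
      exact pow_apply_mem_of_le N D d hDN hr (not_lt.1 hj)
  | zero => exact ⟨0, by simp only [Pi.zero_apply, zero_smul, sum_const_zero, sub_zero]; exact N.zero_mem⟩
  | add x y _ _ hx hy =>
    obtain ⟨a, ha⟩ := hx
    obtain ⟨b, hb⟩ := hy
    refine ⟨a + b, ?_⟩
    have e : x + y - ∑ j ∈ range r, (a + b) j • (D ^ j) d =
        (x - ∑ j ∈ range r, a j • (D ^ j) d) + (y - ∑ j ∈ range r, b j • (D ^ j) d) := by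
      simp only [Pi.add_apply, add_smul, sum_add_distrib]; abel
    rw [e]; exact N.add_mem ha hb
  | neg x _ hx =>
    obtain ⟨a, ha⟩ := hx
    refine ⟨-a, ?_⟩
    have e : -x - ∑ j ∈ range r, (-a) j • (D ^ j) d = -(x - ∑ j ∈ range r, a j • (D ^ j) d) := by
      simp only [Pi.neg_apply, neg_smul, sum_neg_distrib]; abel
    rw [e]; exact N.neg_mem ha

/-- **Independence modulo `N`.** Let `p` be a prime with `pV ⊆ N`, `D N ⊆ N`, and let `r` be minimal with `D^r d ∈ N`
(`D^j d ∉ N` for `j < r`). If `∑_{j<r} a_j D^j d ∈ N` then `p ∣ a_j` for every `j < r`: otherwise, at the least index `j₀`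
with `p ∤ a_{j₀}`, applying `D^{r−1−j₀}` leaves `a_{j₀} D^{r−1} d ∈ N`, and Bézout (`u p + w a_{j₀} = 1`) forces
`D^{r−1} d ∈ N`. [folklore] -/
theorem dvd_coeff_of_sum_mem (p : ℕ) [hp : Fact p.Prime] (hpN : ∀ v : V, (p : ℤ) • v ∈ N)
    (hDN : ∀ v ∈ N, D v ∈ N) {r : ℕ} (hr : (D ^ r) d ∈ N) (hmin : ∀ j < r, (D ^ j) d ∉ N) (a : ℕ → ℤ)
    (h : ∑ j ∈ range r, a j • (D ^ j) d ∈ N) : ∀ j < r, (p : ℤ) ∣ a j := by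
  classical
  by_contra hcon
  simp only [not_forall] at hcon
  have hex : ∃ j, j < r ∧ ¬ (p : ℤ) ∣ a j := by
    obtain ⟨j, hj, hj'⟩ := hcon
    exact ⟨j, hj, hj'⟩
  let j0 := Nat.find hex
  have hj0 : j0 < r ∧ ¬ (p : ℤ) ∣ a j0 := Nat.find_spec hex
  have hlt : ∀ j < j0, j < r → (p : ℤ) ∣ a j := fun j hj hjr ↦ by
    by_contra h'
    exact Nat.find_min hex hj ⟨hjr, h'⟩
  -- apply `D^m`, `m = r - 1 - j0`
  set m := r - 1 - j0 with hm
  have h2 : ∑ j ∈ range r, a j • (D ^ (m + j)) d ∈ N := by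
    have := pow_apply_mem_of_mem N D hDN m h
    rw [map_sum] at this
    simp_rw [map_zsmul, pow_apply_pow_apply] at this
    exact this
  -- every term except `j0` lies in `N`
  have hrest : ∑ j ∈ (range r).erase j0, a j • (D ^ (m + j)) d ∈ N := by
    refine sum_mem fun j hj ↦ ?_
    obtain ⟨hne, hjr⟩ := mem_erase.1 hj
    rw [mem_range] at hjr
    rcases lt_or_gt_of_ne hne with hlt' | hgt
    · obtain ⟨c, hc⟩ := hlt j hlt' hjr
      rw [hc, mul_comm, mul_smul]
      exact N.zsmul_mem (hpN _) _
    · exact N.zsmul_mem (pow_apply_mem_of_le N D d hDN hr (by omega)) _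
  have hj0term : a j0 • (D ^ (m + j0)) d ∈ N := by
    have hsplit := sum_erase_add (range r) (fun j ↦ a j • (D ^ (m + j)) d) (mem_range.2 hj0.1)
    have e : a j0 • (D ^ (m + j0)) d =
        ∑ j ∈ range r, a j • (D ^ (m + j)) d - ∑ j ∈ (range r).erase j0, a j • (D ^ (m + j)) d := by
      rw [← hsplit]; abel
    rw [e]; exact N.sub_mem h2 hrest
  have hmj0 : m + j0 = r - 1 := by omega
  rw [hmj0] at hj0term
  -- Bézout
  have hcop : IsCoprime (p : ℤ) (a j0) :=
    (Prime.coprime_iff_not_dvd (Nat.prime_iff_prime_int.mp hp.out)).mpr hj0.2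
  obtain ⟨u, w, huw⟩ := hcop
  apply hmin (r - 1) (by omega)
  have e : (D ^ (r - 1)) d = u • ((p : ℤ) • (D ^ (r - 1)) d) + w • (a j0 • (D ^ (r - 1)) d) := by
    rw [← mul_smul, ← mul_smul, ← add_smul, huw, one_smul]
  rw [e]
  exact N.add_mem (N.zsmul_mem (hpN _) _) (N.zsmul_mem hj0term _)

/-- **THE SOCLE LEMMA (modulo `N`).** Let `p` be a prime, `N ≤ V` with `pV ⊆ N`, `D` an additive endomorphism of `V` with
`D N ⊆ N`, `d ∈ V` with `D^r d ∈ N` for some `r`, and suppose `V = ⟨D^j d : j⟩ + N`. Then there is `s ∈ V` (namely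
`D^{r−1} d` for the least such `r`) with: every `v` with `D v ∈ N` satisfies `v ≡ c·s (mod N)` for some `c ∈ ℤ`. (Over
`𝔽_p[x]/(x^r) ∋ x ↦ D`: the fixed vectors of a monogenic module form the line spanned by `x^{r−1}·`generator.)
[cite: SerreLocalFields1979, VIII §4 and IX §1] -/
theorem exists_socle_generator (p : ℕ) [Fact p.Prime] (hpN : ∀ v : V, (p : ℤ) • v ∈ N)
    (hDN : ∀ v ∈ N, D v ∈ N) (hnil : ∃ r : ℕ, (D ^ r) d ∈ N)
    (hspan : ∀ v : V, ∃ n ∈ N, v - n ∈ AddSubgroup.closure (Set.range fun j : ℕ ↦ (D ^ j) d)) :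
    ∃ s : V, ∀ v : V, D v ∈ N → ∃ c : ℤ, v - c • s ∈ N := by
  classical
  set r := Nat.find hnil with hrdef
  have hr : (D ^ r) d ∈ N := Nat.find_spec hnil
  have hmin : ∀ j < r, (D ^ j) d ∉ N := fun j hj ↦ Nat.find_min hnil hj
  -- the normal form of an arbitrary `v`
  have hnf : ∀ v : V, ∃ a : ℕ → ℤ, v - ∑ j ∈ range r, a j • (D ^ j) d ∈ N := by
    intro v
    obtain ⟨n, hn, hvn⟩ := hspan v
    obtain ⟨a, ha⟩ := exists_sum_sub_mem_of_mem_closure N D d hDN hr hvn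
    refine ⟨a, ?_⟩
    have e : v - ∑ j ∈ range r, a j • (D ^ j) d = (v - n - ∑ j ∈ range r, a j • (D ^ j) d) + n := by abel
    rw [e]; exact N.add_mem ha hn
  rcases Nat.eq_zero_or_pos r with hr0 | hrpos
  · -- `d ∈ N`: everything is `≡ 0`
    refine ⟨0, fun v _ ↦ ⟨0, ?_⟩⟩
    obtain ⟨a, ha⟩ := hnf v
    rw [hr0, sum_range_zero, sub_zero] at ha
    rwa [zero_smul, sub_zero]
  · obtain ⟨r', hr'⟩ : ∃ r', r = r' + 1 := ⟨r - 1, by omega⟩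
    refine ⟨(D ^ r') d, fun v hv ↦ ?_⟩
    obtain ⟨a, hvw⟩ := hnf v
    -- `D w ∈ N` for the normal form `w`
    have hDw : ∑ j ∈ range r, a j • (D ^ (j + 1)) d ∈ N := by
      have h1 := N.sub_mem hv (hDN _ hvw)
      rw [map_sub, sub_sub_cancel, map_sum] at h1
      simp_rw [map_zsmul] at h1
      have e : ∀ j, D ((D ^ j) d) = (D ^ (j + 1)) d := fun j ↦ by
        rw [pow_succ', addMonoidEnd_mul_apply]
      simp_rw [e] at h1
      exact h1
    rw [hr', sum_range_succ] at hDw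
    have hlast : a r' • (D ^ (r' + 1)) d ∈ N := N.zsmul_mem (by rw [← hr']; exact hr) _
    have hfirst : ∑ j ∈ range r', a j • (D ^ (j + 1)) d ∈ N := by
      have := N.sub_mem hDw hlast
      rwa [add_sub_cancel_right] at this
    -- reindex: `b 0 = 0`, `b (i+1) = a i`
    let b : ℕ → ℤ := fun i ↦ if i = 0 then 0 else a (i - 1)
    have hb : ∑ i ∈ range r, b i • (D ^ i) d = ∑ j ∈ range r', a j • (D ^ (j + 1)) d := by
      rw [hr', sum_range_succ']
      simp only [b, if_true, zero_smul, add_zero, Nat.add_one_ne_zero, if_false, Nat.add_sub_cancel]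
    have hbN : ∑ i ∈ range r, b i • (D ^ i) d ∈ N := hb ▸ hfirst
    have hdvd := dvd_coeff_of_sum_mem N D d p hpN hDN hr hmin b hbN
    have hdvd' : ∀ j < r', (p : ℤ) ∣ a j := fun j hj ↦ by
      have := hdvd (j + 1) (by omega)
      simpa only [b, Nat.add_one_ne_zero, if_false, Nat.add_sub_cancel] using this
    -- the first `r'` terms of `w` lie in `N`
    have hw1 : ∑ j ∈ range r', a j • (D ^ j) d ∈ N := sum_mem fun j hj ↦ by
      obtain ⟨c, hc⟩ := hdvd' j (mem_range.1 hj)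
      rw [hc, mul_comm, mul_smul]
      exact N.zsmul_mem (hpN _) _
    refine ⟨a r', ?_⟩
    have e : v - a r' • (D ^ r') d = (v - ∑ j ∈ range r, a j • (D ^ j) d) + ∑ j ∈ range r', a j • (D ^ j) d := by
      rw [hr', sum_range_succ]; abel
    rw [e]; exact N.add_mem hvw hw1

/-- **Nilpotency modulo `p`.** For an additive endomorphism `φ` of `V` and `d` with `φ^{p^a} d = d`:
`((φ − 1)^{p^a}) d ∈ N` for every subgroup `N ⊇ pV` (binomial theorem for the commuting pair `(φ, −1)`:
`(φ − 1)^{p^a} = φ^{p^a} + (−1)^{p^a} + p·(…)`, and `d + (−1)^{p^a} d ∈ {0, 2d}` with `2d = p·d` when `p^a` is even).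
[folklore] -/
theorem pow_prime_pow_sub_one_apply_mem (p : ℕ) [hp : Fact p.Prime] (hpN : ∀ v : V, (p : ℤ) • v ∈ N)
    (φ : AddMonoid.End V) (a : ℕ) (hfix : (φ ^ (p ^ a)) d = d) : ((φ - 1) ^ (p ^ a)) d ∈ N := by
  have hbin := Commute.add_pow_prime_pow_eq' hp.out (Commute.neg_one_right φ) a
  rw [← sub_eq_add_neg] at hbin
  rw [hbin, addMonoidEnd_add_apply, addMonoidEnd_add_apply, hfix, addMonoidEnd_mul_apply,
    AddMonoid.End.natCast_apply, ← natCast_zsmul]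
  refine N.add_mem ?_ (hpN _)
  rcases Nat.even_or_odd (p ^ a) with hev | hodd
  · rw [hev.neg_one_pow, AddMonoid.End.one_apply]
    -- `p^a` even forces `p = 2`, and `d + d = 2 • d`
    have hp2 : p = 2 := by
      rcases hp.out.eq_two_or_odd' with h2 | hodd'
      · exact h2
      · exact absurd hev (Nat.not_even_iff_odd.mpr hodd'.pow)
    have e : d + d = (p : ℤ) • d := by rw [hp2, Nat.cast_ofNat, two_smul]
    rw [e]; exact hpN d
  · rw [hodd.neg_one_pow, addMonoidEnd_neg_apply, AddMonoid.End.one_apply, add_neg_cancel]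
    exact N.zero_mem

/-- **The orbit span is the `D`-span**: `⟨φ^j d⟩_j ≤ ⟨(φ − 1)^j d⟩_j` (the latter contains `d` and is `φ`-stable:
`φ((φ−1)^j d) = (φ−1)^{j+1} d + (φ−1)^j d`). [folklore] -/
theorem closure_range_pow_smul_le (φ : AddMonoid.End V) :
    AddSubgroup.closure (Set.range fun j : ℕ ↦ (φ ^ j) d) ≤
      AddSubgroup.closure (Set.range fun j : ℕ ↦ ((φ - 1) ^ j) d) := by
  set C := AddSubgroup.closure (Set.range fun j : ℕ ↦ ((φ - 1) ^ j) d) with hC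
  -- `C` is `φ`-stable
  have hstab : ∀ v ∈ C, φ v ∈ C := by
    intro v hv
    induction hv using AddSubgroup.closure_induction with
    | mem x hx =>
      obtain ⟨j, rfl⟩ := hx
      have e : φ (((φ - 1) ^ j) d) = ((φ - 1) ^ (j + 1)) d + ((φ - 1) ^ j) d := by
        rw [pow_succ', addMonoidEnd_mul_apply, addMonoidEnd_sub_apply, AddMonoid.End.one_apply]
        abel
      rw [e]
      exact C.add_mem (AddSubgroup.subset_closure ⟨j + 1, rfl⟩) (AddSubgroup.subset_closure ⟨j, rfl⟩)
    | zero => rw [map_zero]; exact C.zero_mem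
    | add x y _ _ hx hy => rw [map_add]; exact C.add_mem hx hy
    | neg x _ hx => rw [map_neg]; exact C.neg_mem hx
  have key : ∀ j : ℕ, (φ ^ j) d ∈ C := fun j ↦ by
    induction j with
    | zero =>
      rw [pow_zero, AddMonoid.End.one_apply]
      have e : d = ((φ - 1) ^ 0 : AddMonoid.End V) d := by rw [pow_zero, AddMonoid.End.one_apply]
      rw [e]; exact AddSubgroup.subset_closure ⟨0, rfl⟩
    | succ j ih => rw [pow_succ', addMonoidEnd_mul_apply]; exact hstab _ ih
  refine (AddSubgroup.closure_le C).2 ?_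
  rintro _ ⟨j, rfl⟩
  exact key j

end Socle

end Summit.BirchSwinnertonDyer.BirchSwinnertonDyer.Theorems.SignedEC
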